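import Literature.Analysis.OperatorTheory.Enflo2023.Vy
import HarnessLib

/-!
# Enflo 2023, v2 p.6: `V_y` is a compact operator; `V_y V_y^*` is compact, self-adjoint and `≥ 0`

Source under adjudication: Per H. Enflo, *On the invariant subspace problem in Hilbert spaces*, arXiv:2305.15442 (v1
2023, v2 2024), bib key `Enflo2023` — a CLAIMED proof of the invariant subspace problem for operators on a separable
Hilbert space.  This file is part of the kernel-tight typing of the manuscript by the b2b-enflo repair cell
(formaliser 1, Part A: v2 eq. (1)–(27), the set-up, the constructions `V_y`, `ℓ'`, `[ ]x₀`, Lemma 1 and Case I/II of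
the main step).  It records what FOLLOWS (proved implications from the manuscript's displayed hypotheses) and, where a
step does not follow, the typed inference together with its refutation.  NOTHING here asserts that the manuscript's
main theorem holds; no declaration concludes the invariant subspace problem for an arbitrary operator.  Value
(BLOCK-2b): theorems / refutations of typed inferences about a text — not progress on the problem.

THE STEP (v2 p.6, after (15)): "`V_y V_y^*` is a compact, self-adjoint operator, `≥ 0`" (used from (28) on, where
`(I + V_yV_y^*)` and its inverse are manipulated).  Typed and CLOSED here for the paper's `V_y : ℓ² → H`,
`V_y a = Σ_j a_j T^j y`, `‖T‖ < 1` (`Vy.V`, eq. (2)):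
* `Vy.isCompactOperator_V` — `V_y` itself is compact: it is the operator-norm limit of the finite-rank truncations
  `F_N a = Σ_{j<N} a_j T^j y`, because `V_y − F_N = T^N ∘ V_y ∘ L^N` (iterate the first-coefficient decomposition
  `V_y = (a ↦ a₀y) + T ∘ V_y ∘ L`, `Vy.V_decomp`) has norm `≤ ‖T‖^N ‖V_y‖ → 0`, and each `F_N` is a finite sum of
  rank-one operators `T^j ∘ (a ↦ a₀ y) ∘ L^j` (rank one = continuous functional into the locally compact `ℂ`
  followed by `c ↦ c•v`);
* `Vy.isCompactOperator_V_comp_adjoint`, `Vy.isPositive_V_comp_adjoint`, `Vy.isSelfAdjoint_V_comp_adjoint`,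
  `Vy.re_inner_V_comp_adjoint_nonneg` — the three properties the text states, for `V_y ∘ V_y†` (Mathlib:
  `S ∘ S†` is positive; compact ∘ bounded is compact).
STATUS: CLOSED (zero sorry); row A12 of the cell's claim table.  No new axioms.
-/

open scoped InnerProductSpace
open Filter Topology

noncomputable section

namespace Literature.Analysis.OperatorTheory.Enflo2023

namespace Vy

variable {H : Type*} [NormedAddCommGroup H] [InnerProductSpace ℂ H] [CompleteSpace H]

/-- `‖L‖ ≤ 1` for the left shift. [folklore] -/
lemma norm_L_le : ‖(L : ℓ2 →L[ℂ] ℓ2)‖ ≤ 1 :=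
  LinearMap.mkContinuous_norm_le _ zero_le_one _

omit [CompleteSpace H] in
/-- The coordinate functional `a ↦ a₀` as `⟪e₀, ·⟫` on `ℓ²`. [folklore] -/
lemma innerSL_single_zero_apply (a : ℓ2) :
    innerSL ℂ (lp.single 2 0 (1 : ℂ) : ℓ2) a = a 0 := by
  rw [innerSL_apply_apply, lp.inner_single_left]
  simp

/-- **The head operator** `a ↦ a₀ • y` (rank one: the functional `⟪e₀, ·⟫` followed by `c ↦ c • y`). [cite: Enflo2023, v2 pp.8–13 (ℓ(T)y = a₀y + tail)] -/
def head (y : H) : ℓ2 →L[ℂ] H :=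
  (ContinuousLinearMap.toSpanSingleton ℂ y).comp (innerSL ℂ (lp.single 2 0 (1 : ℂ) : ℓ2))

omit [CompleteSpace H] in
/-- `head y a = a₀ • y`. [cite: Enflo2023, v2 pp.8–13 (ℓ(T)y = a₀y + tail)] -/
@[simp] lemma head_apply (y : H) (a : ℓ2) : head y a = a 0 • y := by
  rw [head, ContinuousLinearMap.comp_apply, innerSL_single_zero_apply,
    ContinuousLinearMap.toSpanSingleton_apply]

omit [CompleteSpace H] in
/-- A rank-one operator is compact (`ℂ` is locally compact). [folklore] -/
lemma isCompactOperator_head (y : H) : IsCompactOperator (head y) :=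
  (isCompactOperator_of_locallyCompactSpace_dom (innerSL ℂ (lp.single 2 0 (1 : ℂ) : ℓ2))).continuous_comp
    (ContinuousLinearMap.toSpanSingleton ℂ y).continuous

/-- **Finite-rank truncations** `F_N = Σ_{j<N} T^j ∘ head ∘ L^j` (`F_N a = Σ_{j<N} a_j T^j y`), defined
recursively. [cite: Enflo2023, v2 p.2, eq. (2)] -/
def trunc (T : H →L[ℂ] H) (y : H) : ℕ → (ℓ2 →L[ℂ] H)
  | 0 => 0
  | N + 1 => trunc T y N + ((T ^ N).comp (head y)).comp (L ^ N)

omit [CompleteSpace H] in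
/-- Each truncation is a compact operator (finite sum of rank-one operators composed with bounded ones). [folklore] -/
lemma isCompactOperator_trunc (T : H →L[ℂ] H) (y : H) (N : ℕ) : IsCompactOperator (trunc T y N) := by
  induction N with
  | zero =>
      show IsCompactOperator ((0 : ℓ2 →L[ℂ] H) : ℓ2 → H)
      rw [FunLike.coe_zero]
      exact isCompactOperator_zero
  | succ N ih =>
      show IsCompactOperator ((trunc T y N + ((T ^ N).comp (head y)).comp (L ^ N) : ℓ2 →L[ℂ] H) : ℓ2 → H)
      rw [FunLike.coe_add]
      exact ih.add (((isCompactOperator_head y).comp_clm (L ^ N)).clm_comp (T ^ N))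

/-- **`V_y = F_N + T^N ∘ V_y ∘ L^N`** — the first-coefficient decomposition `Vy.V_decomp` iterated `N` times. [cite: Enflo2023, v2 pp.8–13 (ℓ(T)y = a₀y + tail)] -/
theorem V_eq_trunc_add (T : H →L[ℂ] H) (hT : ‖T‖ < 1) (y : H) (N : ℕ) (a : ℓ2) :
    V T hT y a = trunc T y N a + (T ^ N) (V T hT y ((L ^ N) a)) := by
  induction N with
  | zero => simp [trunc]
  | succ N ih =>
      rw [ih]
      simp only [trunc, add_apply, ContinuousLinearMap.coe_comp, Function.comp_apply, head_apply]
      rw [V_decomp T hT y ((L ^ N) a), map_add, map_smul, pow_succ T N, pow_succ' L N,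
        mul_apply_eq_comp, mul_apply_eq_comp, add_assoc]

/-- **Truncation error** `‖V_y − F_N‖ ≤ ‖T‖^N · ‖y‖(1 − ‖T‖²)^{-1/2}`. [folklore] -/
theorem norm_V_sub_trunc_le (T : H →L[ℂ] H) (hT : ‖T‖ < 1) (y : H) (N : ℕ) :
    ‖V T hT y - trunc T y N‖ ≤ ‖T‖ ^ N * (‖y‖ * Real.sqrt (1 / (1 - ‖T‖ ^ 2))) := by
  refine ContinuousLinearMap.opNorm_le_bound _ (by positivity) (fun a => ?_)
  rw [sub_apply, V_eq_trunc_add T hT y N a, add_sub_cancel_left]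
  have hL : ‖(L ^ N) a‖ ≤ ‖a‖ := by
    have h := (L ^ N).le_of_opNorm_le (IsMinimal.opNorm_pow_le_one L norm_L_le N) a
    rwa [one_mul] at h
  calc ‖(T ^ N) (V T hT y ((L ^ N) a))‖ ≤ ‖T‖ ^ N * ‖V T hT y ((L ^ N) a)‖ := norm_pow_apply_le T N _
    _ ≤ ‖T‖ ^ N * ((‖y‖ * Real.sqrt (1 / (1 - ‖T‖ ^ 2))) * ‖(L ^ N) a‖) := by
        gcongr; exact (V T hT y).le_of_opNorm_le (norm_V_le T hT y) _
    _ ≤ ‖T‖ ^ N * ((‖y‖ * Real.sqrt (1 / (1 - ‖T‖ ^ 2))) * ‖a‖) := by gcongr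
    _ = ‖T‖ ^ N * (‖y‖ * Real.sqrt (1 / (1 - ‖T‖ ^ 2))) * ‖a‖ := by ring

/-- The truncations converge to `V_y` in operator norm (`‖T‖ < 1`). [folklore] -/
theorem tendsto_trunc (T : H →L[ℂ] H) (hT : ‖T‖ < 1) (y : H) :
    Tendsto (fun N => trunc T y N) atTop (𝓝 (V T hT y)) := by
  rw [tendsto_iff_norm_sub_tendsto_zero]
  have h0 := (tendsto_pow_atTop_nhds_zero_of_lt_one (norm_nonneg T) hT).mul_const
    (‖y‖ * Real.sqrt (1 / (1 - ‖T‖ ^ 2)))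
  rw [zero_mul] at h0
  exact squeeze_zero (fun N => norm_nonneg _)
    (fun N => by rw [norm_sub_rev]; exact norm_V_sub_trunc_le T hT y N) h0

/-- **`V_y` is a compact operator** (`‖T‖ < 1`): norm limit of compact (finite-rank) truncations. [cite: Enflo2023, v2 p.6 (V_yV_y^* compact)] -/
theorem isCompactOperator_V (T : H →L[ℂ] H) (hT : ‖T‖ < 1) (y : H) : IsCompactOperator (V T hT y) :=
  isCompactOperator_of_tendsto (l := atTop) (tendsto_trunc T hT y)
    (Eventually.of_forall fun N => isCompactOperator_trunc T y N)

/-- **p.6: `V_y V_y^*` is compact.** [cite: Enflo2023, v2 p.6 (V_yV_y^* compact)] -/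
theorem isCompactOperator_V_comp_adjoint (T : H →L[ℂ] H) (hT : ‖T‖ < 1) (y : H) :
    IsCompactOperator (V T hT y ∘L ContinuousLinearMap.adjoint (V T hT y)) :=
  (isCompactOperator_V T hT y).comp_clm (ContinuousLinearMap.adjoint (V T hT y))

/-- Also `V_y^* V_y` (the Gram operator of (4)) is compact. [cite: Enflo2023, v2 p.2, eq. (4)] -/
theorem isCompactOperator_adjoint_comp_V (T : H →L[ℂ] H) (hT : ‖T‖ < 1) (y : H) :
    IsCompactOperator (ContinuousLinearMap.adjoint (V T hT y) ∘L V T hT y) :=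
  (isCompactOperator_V T hT y).clm_comp (ContinuousLinearMap.adjoint (V T hT y))

/-- **p.6: `V_y V_y^* ≥ 0`** (positive operator). [cite: Enflo2023, v2 p.6 (V_yV_y^* ≥ 0)] -/
theorem isPositive_V_comp_adjoint (T : H →L[ℂ] H) (hT : ‖T‖ < 1) (y : H) :
    (V T hT y ∘L ContinuousLinearMap.adjoint (V T hT y)).IsPositive :=
  ContinuousLinearMap.isPositive_self_comp_adjoint _

/-- **p.6: `V_y V_y^*` is self-adjoint.** [cite: Enflo2023, v2 p.6 (V_yV_y^* self-adjoint)] -/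
theorem isSelfAdjoint_V_comp_adjoint (T : H →L[ℂ] H) (hT : ‖T‖ < 1) (y : H) :
    IsSelfAdjoint (V T hT y ∘L ContinuousLinearMap.adjoint (V T hT y)) :=
  (isPositive_V_comp_adjoint T hT y).isSelfAdjoint

/-- `⟨V_yV_y^* x, x⟩ = ‖V_y^* x‖² ≥ 0` in the form `0 ≤ re ⟪V_yV_y^* x, x⟫`. [cite: Enflo2023, v2 p.6 (V_yV_y^* ≥ 0)] -/
theorem re_inner_V_comp_adjoint_nonneg (T : H →L[ℂ] H) (hT : ‖T‖ < 1) (y x : H) :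
    0 ≤ (⟪(V T hT y ∘L ContinuousLinearMap.adjoint (V T hT y)) x, x⟫_ℂ).re :=
  (isPositive_V_comp_adjoint T hT y).re_inner_nonneg_left x

/-- Hence `I + V_yV_y^*` is positive as well (the operator inverted in (28) ff.). [cite: Enflo2023, v2 p.13, eq. (28)] -/
theorem isPositive_one_add_V_comp_adjoint (T : H →L[ℂ] H) (hT : ‖T‖ < 1) (y : H) :
    (1 + V T hT y ∘L ContinuousLinearMap.adjoint (V T hT y)).IsPositive :=
  ContinuousLinearMap.isPositive_one.add (isPositive_V_comp_adjoint T hT y)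

end Vy

end Literature.Analysis.OperatorTheory.Enflo2023

end
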